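import Summits.BirchSwinnertonDyer.BirchSwinnertonDyer.Theorems.TwoAdicConverseLambdaHalfTowerDoor
import Summits.BirchSwinnertonDyer.BirchSwinnertonDyer.Theorems.TwoAdicConverseLambdaHalfTowerGVTransport
import Summits.BirchSwinnertonDyer.BirchSwinnertonDyer.Theorems.ByReductionTypeAtTwoTowerClass496995c
import HarnessLib

/-!
# Route `TwoAdicConverse` (rung S3), crux `OrdLambdaHalfAtTwo` (item 19556): the `λ`-half KATO-FREE at the K4 tower class **496995c**
# (member `496995c1`, `N = 496995 = 3·5·17·1949`, `E[2]` irreducible, `λ_an = 9`) — the rank count read in the EXACT currency `#A_3[2]`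

Cell `bsd-2adic` (run/shared/lean/pub/bsd-2adic/), seat `bsd-2adic-conv-1x` (WIDTH-LEVER second lane on item 19556, GEN 4).
THEOREMS ONLY — no definition, no named fact, no axiom, no `sorry`; the curve `c496995c1`, its kernel-decided data and its gap theorem
`towerGapAtTwo_496995c1_B03` are the K4 class file's (`ByReductionTypeAtTwoTowerClass496995c`, seat ord-2), imported, never re-typed.

WHY THIS FILE. conv-1x GEN 0 left `496995c` BY NAME only (`lambdaHalfAtTwo_496995c1_of_towerGap` ∘ Mazur's IMC, Kato 17.4 INCLUDED)
because its CLASSICAL layer counts stop short of `λ_an = 9` (tower/TABLE-TOWER-E1 `d = (2,3,3,7)`: «a Kato-free row needs a layer-4 count»).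
But the K4 class is CLOSED on road B with BOTH counts in the exact currency `A_j = h_j⁻¹(Sel_{2^∞}(E/ℚ_∞)) ⊆ H¹(ℚ_j, E[2^∞])`
(`bsdp_two_496995c1_B03`: `2^3 ≤ #A_0[2]`, `#A_3[2] ≤ 2^9`), and in THAT currency the layer-`3` count SATURATES: `e₃ = ehi₃ = 9`, exact,
THREE readings — ENGINE A j253160 (tower/TABLE-TOWER-E1-j3), ENGINE B2 v2.1 (tower/TABLE-TOWER-E1-EB2-Q4: `e 9 / ehi 9 / eexact 1`), ENGINE G
j271795 (`tower/TABLE-TOWER-E1-G-CERT-T4.tsv`: `cert = 1`, GRH-free, values of record reproduced). conv-1x GEN 2's kernel count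
`TwoAdicTwistConverse.towerRank_of_selmerInftyPreimageTwoTorsion` (`2^n ≤ #A_j[2]` ⟹ `2^n ≤ #X/(2,T^{2^j})X`, odd torsion) turns that LOWER
count into the tower-currency rank certificate of GEN 0's door `lambdaHalfAtTwo_of_towerGap_of_towerRank_of_abbesUllmo`. Hence:
* `lambdaHalfAtTwo_496995c1_lambdaRoad_B03A3` — **item 19556's leaf AT `496995c1`, KATO-FREE**: PRINT {`hmod`, Greenberg 4.14@2 `h414`,
  Abbes–Ullmo `hAU`} + CERT {the K4 close's own gap counts `2^3 ≤ #A_0[2]`, `#A_3[2] ≤ 2^9` (road B, pair `(0,3)`), the LOWER count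
  `2^9 ≤ #A_3[2]` (the same `e₃ = 9`, read from below), `λ_an = 9` (CERT-ORD-OPEN528)} ⟹ `LambdaHalfAtTwo c496995c1`. No Kato 17.4, no
  `μ_an`, no Greenberg 4.1, no GZK, no `Ш` datum, no layer-`4` count.
* `lambdaHalfAtTwo_496995c1_lambdaRoad_A03A3` — the same with the gap's lower count classical (`2^a ≤ #Sel_{2^∞}(E/ℚ)[2]`, table `d₀ = 2`,
  three sources; K4 `towerGapAtTwo_496995c1_A03`, `d + 1 ≤ 7 + a`).

HONEST FRAMING: class-level theorems modulo the displayed binders and certificates (the `A_j`-currency lower count carries the engineer's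
`ℚ_∞`-induced local reading at `v ∣ 2`, CERT-TOWER-E1 §1 (i), exactly as every booked road-B / GVI-T row of the cell); nothing is booked by this
file (D-0054); item 19556 (= the `λ`-part of Kato's `2`-adic main conjecture on «non-CM, good ordinary at `2`») stays OPEN at the `∀`-level;
BSD is not proved by any of this; a closed item would close a rung leaf (S3), never the summit. PARTITION (D-0054): none — RANK axis (S3);
companion formula cell X5@2 good-ord (B1·O1; K4 TOWER habitat, class 496995c, K4-CLOSED); types-the-object-of; closes none; bears_on: S3 (19556).

References: R. Greenberg, LNM 1716 (1999), §1 p. 60, §3 pp. 85–86, Prop. 4.14 [GreenbergLNM1716]; A. Abbes, E. Ullmo, Compositio 103 (1996),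
Thm. A [AbbesUllmo1996]; L. Washington, GTM 83, §13.2 [Washington1997]; R. Greenberg, V. Vatsal, Invent. Math. 142 (2000), p. 4 [GreenbergVatsal2000].
-/

set_option autoImplicit false
-- the Theorems namespace of this sub repeats the summit name by design (D-0017 nested layout: Summit.<S>.<Sub>)
set_option linter.dupNamespace false

noncomputable section

open scoped Classical MatrixGroups ModularForm

open NumberField IsDedekindDomain CongruenceSubgroup WeierstrassCurve Literature.NumberTheory.EllipticCurves
  Literature.NumberTheory.EllipticCurves.ModularForms Literature.NumberTheory.EllipticCurves.Rank1Residual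
  Literature.NumberTheory.EllipticCurves.Rank1Residual.Typed
  Literature.NumberTheory.EllipticCurves.Greenberg1999
  Summit.BirchSwinnertonDyer.Rank1Residual.X1.MuLambda
  Summit.BirchSwinnertonDyer.Rank1Residual.X1.MuPart
  Summit.BirchSwinnertonDyer.Rank1Residual.X1.ParitySqueeze
  Summit.BirchSwinnertonDyer.Rank1Residual.X5 Summit.BirchSwinnertonDyer.Rank1Residual.X5.O1
  Summit.BirchSwinnertonDyer.Rank1Residual.X5.TowerGap Summit.BirchSwinnertonDyer.Rank1Residual
  Summit.BirchSwinnertonDyer.Rank1Residual.X5.Instances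
  Summit.BirchSwinnertonDyer.BirchSwinnertonDyer.Theorems
  Summit.BirchSwinnertonDyer.BirchSwinnertonDyer.Theorems.KatoHalfPinch
  Summit.BirchSwinnertonDyer.BirchSwinnertonDyer.Theorems.Rank1ResidualX1Defs

namespace Summit.BirchSwinnertonDyer.BirchSwinnertonDyer.Theorems.TowerClass

/-- **Item 19556's leaf AT `496995c1`, KATO-FREE `λ`-ROAD, road-B gap `(0,3)` + the EXACT-currency layer-`3` rank count.** PRINT {`hmod`,
Greenberg 4.14@2 `h414`, Abbes–Ullmo `hAU`} + CERT {`2^3 ≤ #A_0[2]` and `#A_3[2] ≤ 2^9` (= the displayed certificates of the K4 close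
`bsdp_two_496995c1_B03`: ENGINE A `e₀ = 3`, `ehi₃ = 9` = ENGINE B2 = ENGINE G j271795 `cert = 1`), `2^9 ≤ #A_3[2]` (`e₃ = 9` exact, the same three
readings), `λ_an = 9` (CERT-ORD-OPEN528)} ⟹ `λ(L₂(E)) ≤ λ(X(E/ℚ_∞))`. No Kato, no `μ_an`, no Greenberg 4.1, no GZK, no `Ш` datum.
[cite: GreenbergLNM1716, §1 p. 60, §3 pp. 85–86, Prop. 4.14] [cite: AbbesUllmo1996, Thm. A] [cite: Washington1997, §13.2] -/
theorem lambdaHalfAtTwo_496995c1_lambdaRoad_B03A3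
    (hmod : nonempty_modularParametrizationData) (hAU : abbesUllmo_not_dvd_maninConstant_of_not_dvd_level)
    (h414 : prop414_noFiniteSubmodule_of_not_dvd_torsionOrder)
    (hlow : ∀ κ : ZpExtension ℚ 2, κ.IsCyclotomic →
      2 ^ 3 ≤ Nat.card {z : c496995c1.selmerInftyPreimage κ 0 // 2 • z = 0})
    (hup : ∀ κ : ZpExtension ℚ 2, κ.IsCyclotomic →
      Nat.card {z : c496995c1.selmerInftyPreimage κ 3 // 2 • z = 0} ≤ 2 ^ 9)
    (hpre : ∀ κ : ZpExtension ℚ 2, κ.IsCyclotomic →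
      2 ^ 9 ≤ Nat.card {z : c496995c1.selmerInftyPreimage κ 3 // 2 • z = 0})
    (hlan : AnalyticLambdaEq c496995c1 2 9) : TwoAdicTwistConverse.LambdaHalfAtTwo c496995c1 :=
  TwoAdicTwistConverse.lambdaHalfAtTwo_of_towerGap_of_towerRank_of_abbesUllmo c496995c1 hmod h414 hAU goodOrd_two_496995c1
    irr_two_496995c1 (towerGapAtTwo_496995c1_B03 hlow hup (by norm_num))
    (TwoAdicTwistConverse.towerRank_of_selmerInftyPreimageTwoTorsion c496995c1 not_two_dvd_torsionOrder_496995c1 hpre) hlan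

/-- **Item 19556's leaf AT `496995c1`, KATO-FREE `λ`-ROAD, gap `(0,3)` with a classical lower count** (`2^a ≤ #Sel_{2^∞}(E/ℚ)[2]`, table
`d₀ = 2`, three sources; `#A_3[2] ≤ 2^d`, `d + 1 ≤ 7 + a`; K4 `towerGapAtTwo_496995c1_A03`) + the exact-currency rank count `2^9 ≤ #A_3[2]`
+ `λ_an = 9`. PRINT {`hmod`, `h414`, `hAU`}. [cite: GreenbergLNM1716, §1 p. 60, §3 pp. 85–86, Prop. 4.14] [cite: AbbesUllmo1996, Thm. A] -/
theorem lambdaHalfAtTwo_496995c1_lambdaRoad_A03A3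
    (hmod : nonempty_modularParametrizationData) (hAU : abbesUllmo_not_dvd_maninConstant_of_not_dvd_level)
    (h414 : prop414_noFiniteSubmodule_of_not_dvd_torsionOrder) {a d : ℕ}
    (hlow : ∀ κ : ZpExtension ℚ 2, κ.IsCyclotomic →
      2 ^ a ≤ Nat.card {z : c496995c1.selmerLayer κ 0 // 2 • z = 0})
    (hup : ∀ κ : ZpExtension ℚ 2, κ.IsCyclotomic →
      Nat.card {z : c496995c1.selmerInftyPreimage κ 3 // 2 • z = 0} ≤ 2 ^ d)
    (had : d + 1 ≤ 7 + a)
    (hpre : ∀ κ : ZpExtension ℚ 2, κ.IsCyclotomic →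
      2 ^ 9 ≤ Nat.card {z : c496995c1.selmerInftyPreimage κ 3 // 2 • z = 0})
    (hlan : AnalyticLambdaEq c496995c1 2 9) : TwoAdicTwistConverse.LambdaHalfAtTwo c496995c1 :=
  TwoAdicTwistConverse.lambdaHalfAtTwo_of_towerGap_of_towerRank_of_abbesUllmo c496995c1 hmod h414 hAU goodOrd_two_496995c1
    irr_two_496995c1 (towerGapAtTwo_496995c1_A03 hlow hup had)
    (TwoAdicTwistConverse.towerRank_of_selmerInftyPreimageTwoTorsion c496995c1 not_two_dvd_torsionOrder_496995c1 hpre) hlan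

end Summit.BirchSwinnertonDyer.BirchSwinnertonDyer.Theorems.TowerClass

end
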